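import Summits.HodgeConjecture.HodgeConjecture.Theorems.R90S4EpsNormDiscrPolynomial                -- ★ p864069 (this seat) FILE 1: `discr_charpoly_twistedNorm_eq_zero_of_not_separable`, `exists_mvPolynomial_twistedNorm_discr`, `map_chart_mul_eq_of_fixed`
import Summits.HodgeConjecture.HodgeConjecture.Theorems.R90S4TwistedTransferDefs                    -- ★ S4 currency: `IsEpsRegularAt`, `isEpsRegularAt_iff`; brings `GtLoc`, `epsLoc`, `epsNorm`, `IsRegularElt`, `formLocal`, `twistLocal`
import Summits.HodgeConjecture.HodgeConjecture.Theorems.R90S4SplitFormGL                            -- ★ `splitFormGL` (the quasi-split form of record)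
import Summits.HodgeConjecture.HodgeConjecture.Theorems.K2LiuLocalRingInertReading                  -- ★ `conjLocal_apply_of_smul_eq`, `inert_reading_injective`, `inert_reading_surjective` (one place above a non-split `v`)
import Summits.HodgeConjecture.HodgeConjecture.Theorems.K2E3NormalizedCharBddNearSemisimpleRegular  -- ★ `continuous_discr_charpoly`
import Literature.NumberTheory.Automorphic.QuadraticPlaceDescentPins                                  -- ★ `exists_units_galAdicCompletionMap_eq_neg`; brings ★ `QuadraticLocalBaseChange` (`toPlace`, `continuous_toPlace`, `galAdicCompletionMap_toPlace`)
import Literature.NumberTheory.Automorphic.GodementJacquetLocalNonvanishing                           -- ★ `isOpenEmbedding_generalLinearGroup_val` (`GL_m(K) ↪ M_m(K)` open embedding)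
import Literature.NumberTheory.Automorphic.LocalUnitaryGroupCongr                                     -- ★ `localGLPiEvalEquiv` (one-place model `Π_{w∣v} GL₃(L_w) ≃ₜ* GL₃(L_w)`); brings ★ `localGLPiEquiv`
import Literature.NumberTheory.Automorphic.AdicCompletionLocalField                                   -- ★ instances: `L_w`, `L⁺_v` are non-archimedean local fields (locally compact)
import Literature.NumberTheory.Automorphic.AdelicSecondCountable                                      -- ★ `secondCountableTopology_adicCompletion`
import Literature.NumberTheory.GaloisRepresentations.LocalField                                       -- ★ `IsNonarchimedeanLocalField.isLocalField` (Hausdorff)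
import Literature.MeasureTheory.Constructions.MvPolynomialZeroSetNull                                 -- ★ `measure_eq_zero_of_forall_shear_null`, `pi_zeroLocus_mvPolynomial_eq_zero`
import Mathlib.MeasureTheory.Measure.Haar.Basic
import HarnessLib

/-!
# R90-TF · S4 (Ch. 13.1–2) · brick (SING-ε) — «THE ε-SINGULAR SET OF `G̃_v` IS HAAR-NULL» (non-split `v`)

Dealt by the S4 dealer (K2E2-plan (g7), GO 00:46:48Z; road «=» 01:14:20Z): the `hsing` input of the (B1) twisted Weyl integration formula
(HEADS v2 §3 / S4-R27): for `v` non-split in `L ∕ L⁺`, ANY `Φ ∈ GL₃(L)` and ANY Haar measure `νGt` on `G̃_v = GL₃(L ⊗_{L⁺} L⁺_v)`,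
`measure_setOf_not_isEpsRegularAt_eq_zero (L) (Φ) (v) (hns) (νGt) : νGt {δ | ¬ IsEpsRegularAt L Φ v δ} = 0`, with the `∀ᵐ` corollary and the
`Φ := splitFormGL L` readings (Rogawski p. 186: «the set of ε-regular elements … its complement has measure zero»; twin of §4.9 p. 54).
PROOF ((J8) shear device; no Weyl formula, no Haar-vs-Lebesgue comparison).  §3 ONE-PLACE MODEL: at non-split `v`, evaluation at the unique
`w ∣ v` is a ring isomorphism `L ⊗ L⁺_v ≃ L_w` carrying `σ ⊗ 1` to `σ_w` (★ `conjLocal_apply_of_smul_eq`, ★ `inert_reading_injective∕surjective`),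
under which `N(δ) = δ Φ⁻¹((σδ)⁻¹)ᵀΦ` reads `δ_w · B · ((σ_w δ_w)⁻¹)ᵀ · C` with `B C = 1` and non-separability of `χ_{N δ}` transports; by FILE 1 §2
the image of the ε-singular set lies in the CLOSED set `S₂ = {g | disc χ(g B adj(σ_w g)ᵀ C) = 0}`.  §2 SHEAR (generic, any second-countable
Hausdorff topological field `K`, `char K = 0`, continuous inversion): parameter space `X^{18}` with the product of an atomless σ-finite `μ`
(here `X = L⁺_v`, additive Haar, ★ `nullSingletonClass_of_isAddHaarMeasure`), chart `τ ↦ X_{eτ}` patched to `1` off `{det ≠ 0}` (measurable by ★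
`isOpenEmbedding_generalLinearGroup_val`), `e = ι_w` (`σ_w`-fixed ★ `galAdicCompletionMap_toPlace`), skew unit `θ` (★
`exists_units_galAdicCompletionMap_eq_neg`); every fibre `{τ | ι(τ) g ∈ S₂}` lies in `{det X_{eτ} = 0} ∪ {P_g(eτ) = 0}` (FILE 1 §3–§4), zero sets of
NON-ZERO polynomials (§1: `P_g(y₀) = disc χ(diag(0,1,2)) = 4` at `X_{y₀} = diag(0,1,2) g⁻¹`, `X̄_{y₀} = (σg)⁻¹`), hence null (★
`pi_zeroLocus_mvPolynomial_eq_zero`), and ★ `measure_eq_zero_of_forall_shear_null` gives `ν S₂ = 0`; transport `νGt` along the model (Mathlib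
`ContinuousMulEquiv.isHaarMeasure_map`, `Measure.le_map_apply`).  Count-neutral helper toward `stmt-HodgeConjecture-24833`; no `sorry`, default heartbeats.

References: [Rogawski1990] J. Rogawski, *Automorphic Representations of Unitary Groups in Three Variables* (1990), §12.5 p. 186; §4.9 p. 54; §3.11
p. 34; §4.10 p. 57.  [HarishChandra1970] Harish-Chandra, *Harmonic analysis on reductive p-adic groups*, LNM 162 (1970), Part I §5, Lemma 42.
[Folland1999] G. Folland, *Real Analysis* (1999), §2.5 Thm. 2.37.  [CasselsFrohlichANT1967] Cassels–Fröhlich (eds.), *Algebraic Number Theory* (1967),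
Ch. II §10, Ch. VII §1.1.
-/


set_option autoImplicit false
-- the mandated namespace repeats the single-problem summit's segment (`HodgeConjecture.HodgeConjecture`)
set_option linter.dupNamespace false

noncomputable section

open MeasureTheory Polynomial Matrix Function Set
open NumberField IsDedekindDomain Topology TopologicalSpace
open Literature.NumberTheory.Automorphic Literature.NumberTheory.Automorphic.UnitaryGroup
open Literature.NumberTheory.Rogawski1990 Literature.NumberTheory.Rogawski1990.Ch4Sec10
open Literature.MeasureTheory.Constructions
open Summit.HodgeConjecture.HodgeConjecture.Cruxes.H413
open Summit.HodgeConjecture.HodgeConjecture.Cruxes.HLiu418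
open Summit.HodgeConjecture.HodgeConjecture.Cruxes.H413.K2E1GlobalTestFunctionsTwisted (formLocal twistLocal twistLocal_apply)
open scoped MatrixGroups

namespace Summit.HodgeConjecture.HodgeConjecture.R90.S4

/-! ## §1 Witnesses over a field: the chart hits any pair `(X, X̄)`, the determinant polynomial, one regular value -/

section Witness

variable {K : Type*} [Field K]

/-- **The pair `(X_y, X̄_y)` takes EVERY value** (`2 ≠ 0`, `θ ≠ 0`): `X_y = Y₀ + θ Y₁`, `X̄_y = Y₀ − θ Y₁` with `Y₀ = (P + Q)/2`, `Y₁ = (P − Q)/(2θ)`.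
(The coordinates `y` range over `K^{18}`, not over the fixed field, so `X̄_y` is NOT tied to `σ X_y`.) [cite: Rogawski1990, §3.11 p. 34] -/
theorem exists_chart_eq {θ : K} (hθ : θ ≠ 0) (h2 : (2 : K) ≠ 0) (P Q : Matrix (Fin 3) (Fin 3) K) :
    ∃ y : Fin 18 → K,
      (Matrix.of fun i j : Fin 3 => y (finProdFinEquiv (finProdFinEquiv (i, j), (0 : Fin 2))) +
          θ * y (finProdFinEquiv (finProdFinEquiv (i, j), (1 : Fin 2)))) = P ∧
      (Matrix.of fun i j : Fin 3 => y (finProdFinEquiv (finProdFinEquiv (i, j), (0 : Fin 2))) -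
          θ * y (finProdFinEquiv (finProdFinEquiv (i, j), (1 : Fin 2)))) = Q := by
  classical
  refine ⟨fun n => if ((finProdFinEquiv (m := 3 * 3) (n := 2)).symm n).2 = 0
      then (P ((finProdFinEquiv (m := 3) (n := 3)).symm ((finProdFinEquiv (m := 3 * 3) (n := 2)).symm n).1).1
              ((finProdFinEquiv (m := 3) (n := 3)).symm ((finProdFinEquiv (m := 3 * 3) (n := 2)).symm n).1).2 +
            Q ((finProdFinEquiv (m := 3) (n := 3)).symm ((finProdFinEquiv (m := 3 * 3) (n := 2)).symm n).1).1
              ((finProdFinEquiv (m := 3) (n := 3)).symm ((finProdFinEquiv (m := 3 * 3) (n := 2)).symm n).1).2) / 2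
      else (P ((finProdFinEquiv (m := 3) (n := 3)).symm ((finProdFinEquiv (m := 3 * 3) (n := 2)).symm n).1).1
              ((finProdFinEquiv (m := 3) (n := 3)).symm ((finProdFinEquiv (m := 3 * 3) (n := 2)).symm n).1).2 -
            Q ((finProdFinEquiv (m := 3) (n := 3)).symm ((finProdFinEquiv (m := 3 * 3) (n := 2)).symm n).1).1
              ((finProdFinEquiv (m := 3) (n := 3)).symm ((finProdFinEquiv (m := 3 * 3) (n := 2)).symm n).1).2) / (2 * θ), ?_, ?_⟩
  · ext i j
    simp only [Matrix.of_apply, Equiv.symm_apply_apply, Fin.isValue, if_true, one_ne_zero, if_false]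
    field_simp
    ring
  · ext i j
    simp only [Matrix.of_apply, Equiv.symm_apply_apply, Fin.isValue, if_true, one_ne_zero, if_false]
    field_simp
    ring

/-- **`det X_y` is a non-zero polynomial in `y`** (the determinant of the universal chart matrix; non-zero at the coordinates of `X = 1`).
[cite: HarishChandra1970, Part I §5] -/
theorem exists_mvPolynomial_chart_det (θ : K) :
    ∃ D : MvPolynomial (Fin 18) K,
      (∀ y : Fin 18 → K, MvPolynomial.eval y D =
        (Matrix.of fun i j : Fin 3 => y (finProdFinEquiv (finProdFinEquiv (i, j), (0 : Fin 2))) +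
            θ * y (finProdFinEquiv (finProdFinEquiv (i, j), (1 : Fin 2)))).det) ∧ D ≠ 0 := by
  classical
  let A : Matrix (Fin 3) (Fin 3) (MvPolynomial (Fin 18) K) := Matrix.of fun i j =>
    MvPolynomial.X (finProdFinEquiv (finProdFinEquiv (i, j), (0 : Fin 2))) +
      MvPolynomial.C θ * MvPolynomial.X (finProdFinEquiv (finProdFinEquiv (i, j), (1 : Fin 2)))
  have hA : ∀ y : Fin 18 → K, A.map (MvPolynomial.eval y) =
      Matrix.of fun i j : Fin 3 => y (finProdFinEquiv (finProdFinEquiv (i, j), (0 : Fin 2))) +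
        θ * y (finProdFinEquiv (finProdFinEquiv (i, j), (1 : Fin 2))) := by
    intro y; ext i j
    simp only [A, Matrix.map_apply, Matrix.of_apply, map_add, map_mul, MvPolynomial.eval_X, MvPolynomial.eval_C]
  have hdet : ∀ y : Fin 18 → K, MvPolynomial.eval y A.det = (A.map (MvPolynomial.eval y)).det := by
    intro y
    rw [RingHom.map_det, RingHom.mapMatrix_apply]
  refine ⟨A.det, fun y => by rw [hdet, hA], fun h0 => ?_⟩
  let y₁ : Fin 18 → K := fun n => if ((finProdFinEquiv (m := 3 * 3) (n := 2)).symm n).2 = 0 then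
      (if ((finProdFinEquiv (m := 3) (n := 3)).symm ((finProdFinEquiv (m := 3 * 3) (n := 2)).symm n).1).1 =
          ((finProdFinEquiv (m := 3) (n := 3)).symm ((finProdFinEquiv (m := 3 * 3) (n := 2)).symm n).1).2 then 1 else 0) else 0
  have h1 : (Matrix.of fun i j : Fin 3 => y₁ (finProdFinEquiv (finProdFinEquiv (i, j), (0 : Fin 2))) +
        θ * y₁ (finProdFinEquiv (finProdFinEquiv (i, j), (1 : Fin 2)))) = 1 := by
    ext i j
    simp only [y₁, Matrix.of_apply, Equiv.symm_apply_apply, Fin.isValue, if_true, one_ne_zero, if_false, mul_zero, add_zero,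
      Matrix.one_apply]
  have h := hdet y₁
  rw [h0, map_zero, hA, h1, Matrix.det_one] at h
  exact zero_ne_one h

/-- **ONE REGULAR VALUE of the twisted-norm discriminant** (`char K = 0`, `θ ≠ 0`, `g` invertible, `h` invertible, `B · C = 1`): at `y₀` with
`X_{y₀} = diag(0,1,2)·g⁻¹`, `X̄_{y₀} = h⁻¹` the matrix `X_{y₀} g B adj(X̄_{y₀} h)ᵀ C` is `diag(0,1,2)` (since `adj 1 = 1`), of discriminant
`((0−1)(0−2)(1−2))² = 4 ≠ 0` (★ `discr_charpoly_diagonal`). [cite: HarishChandra1970, Part I §5] [cite: Rogawski1990, §3.11 p. 34] -/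
theorem exists_twistedNorm_discr_ne_zero [CharZero K] {θ : K} (hθ : θ ≠ 0) (g : GL (Fin 3) K) {h : Matrix (Fin 3) (Fin 3) K} (hh : IsUnit h)
    (B C : Matrix (Fin 3) (Fin 3) K) (hBC : B * C = 1) :
    ∃ y₀ : Fin 18 → K,
      ((Matrix.of fun i j : Fin 3 => y₀ (finProdFinEquiv (finProdFinEquiv (i, j), (0 : Fin 2))) +
            θ * y₀ (finProdFinEquiv (finProdFinEquiv (i, j), (1 : Fin 2)))) * (g : Matrix (Fin 3) (Fin 3) K) * B *
        (adjugate ((Matrix.of fun i j : Fin 3 => y₀ (finProdFinEquiv (finProdFinEquiv (i, j), (0 : Fin 2))) -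
            θ * y₀ (finProdFinEquiv (finProdFinEquiv (i, j), (1 : Fin 2)))) * h))ᵀ * C).charpoly.discr ≠ 0 := by
  obtain ⟨y₀, hP, hQ⟩ := exists_chart_eq hθ two_ne_zero
    (Matrix.diagonal ![(0 : K), 1, 2] * ((g⁻¹ : GL (Fin 3) K) : Matrix (Fin 3) (Fin 3) K)) ((hh.unit⁻¹ : (Matrix (Fin 3) (Fin 3) K)ˣ) : Matrix (Fin 3) (Fin 3) K)
  refine ⟨y₀, ?_⟩
  have hg : Matrix.diagonal ![(0 : K), 1, 2] * ((g⁻¹ : GL (Fin 3) K) : Matrix (Fin 3) (Fin 3) K) * (g : Matrix (Fin 3) (Fin 3) K) =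
      Matrix.diagonal ![(0 : K), 1, 2] := by
    rw [Matrix.mul_assoc, ← Units.val_mul, inv_mul_cancel, Units.val_one, Matrix.mul_one]
  have hh' : ((hh.unit⁻¹ : (Matrix (Fin 3) (Fin 3) K)ˣ) : Matrix (Fin 3) (Fin 3) K) * h = 1 := hh.val_inv_mul
  rw [hP, hQ, hg, hh', Matrix.adjugate_one, Matrix.transpose_one, Matrix.mul_one, Matrix.mul_assoc, hBC, Matrix.mul_one,
    K2E3GL3SplitTorusWeylKit.discr_charpoly_diagonal]
  have hval : (![(0 : K), 1, 2] 0 - ![(0 : K), 1, 2] 1) * (![(0 : K), 1, 2] 0 - ![(0 : K), 1, 2] 2) * (![(0 : K), 1, 2] 1 - ![(0 : K), 1, 2] 2) = -2 := by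
    simp only [Matrix.cons_val_zero, Matrix.cons_val_one, Matrix.cons_val_two, Matrix.head_cons, Matrix.tail_cons]
    norm_num
  rw [hval]
  norm_num

end Witness

/-! ## §2 The shear argument over a topological field: `{g | disc χ(g B adj(σg)ᵀ C) = 0}` is null for every left-invariant s-finite measure -/

section Shear

variable {K : Type*} [Field K] [CharZero K] [TopologicalSpace K] [IsTopologicalRing K] [ContinuousInv₀ K] [T2Space K]
  [SecondCountableTopology K] [MeasurableSpace K] [BorelSpace K]

/-- **GENERIC SHEAR THEOREM.**  `K` a second-countable Hausdorff topological field of characteristic `0` with continuous inversion and its Borel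
σ-algebra; `σ : K →+* K` continuous with a skew element `θ ≠ 0` (`σ θ = −θ`); `B · C = 1`; `e : X → K` measurable, injective, with `σ`-fixed
values; `μ ≠ 0` an atomless σ-finite measure on `X`; `ν` a left-invariant s-finite Borel measure on `GL₃(K)`.  Then
`ν {g | disc χ(g · B · adj(σ g)ᵀ · C) = 0} = 0`.  (Shear criterion ★ `measure_eq_zero_of_forall_shear_null` with parameter space `X^{18}` and the
chart `τ ↦ X_{eτ}` patched to `1` off `{det ≠ 0}`; every fibre lies in the union of the zero sets of `det X_y` and of the polynomial `P_g` of ★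
`exists_mvPolynomial_twistedNorm_discr`, both non-zero — ★ `pi_zeroLocus_mvPolynomial_eq_zero`.) [cite: HarishChandra1970, Part I §5, Lemma 42]
[cite: Folland1999, §2.5 Thm. 2.37] [cite: Rogawski1990, §12.5 p. 186] -/
theorem measure_setOf_discr_twistedNorm_eq_zero (σ : K →+* K) (hσ : Continuous σ) {θ : K} (hθ : σ θ = -θ) (hθ0 : θ ≠ 0)
    (B C : Matrix (Fin 3) (Fin 3) K) (hBC : B * C = 1)
    {X : Type*} [MeasurableSpace X] {e : X → K} (he : Measurable e) (hinj : Injective e) (hfix : ∀ x, σ (e x) = e x)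
    (μ : Measure X) [SigmaFinite μ] [NullSingletonClass μ] (hμ : μ ≠ 0)
    [MeasurableSpace (GL (Fin 3) K)] [BorelSpace (GL (Fin 3) K)]
    (ν : Measure (GL (Fin 3) K)) [SFinite ν] [ν.IsMulLeftInvariant] :
    ν {g : GL (Fin 3) K | ((g : Matrix (Fin 3) (Fin 3) K) * B * (adjugate ((g : Matrix (Fin 3) (Fin 3) K).map σ))ᵀ * C).charpoly.discr = 0} = 0 := by
  classical
  letI : MeasurableSpace (Matrix (Fin 3) (Fin 3) K) := inferInstanceAs (MeasurableSpace (Fin 3 → Fin 3 → K))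
  haveI : BorelSpace (Matrix (Fin 3) (Fin 3) K) := inferInstanceAs (BorelSpace (Fin 3 → Fin 3 → K))
  haveI : SecondCountableTopology (Matrix (Fin 3) (Fin 3) K) := inferInstanceAs (SecondCountableTopology (Fin 3 → Fin 3 → K))
  haveI : SecondCountableTopology (Matrix (Fin 3) (Fin 3) K)ᵐᵒᵖ := MulOpposite.opHomeomorph.symm.secondCountableTopology
  haveI : SecondCountableTopology (GL (Fin 3) K) := Units.isEmbedding_embedProduct.secondCountableTopology
  have hval : MeasurableEmbedding (Units.val : GL (Fin 3) K → Matrix (Fin 3) (Fin 3) K) :=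
    (isOpenEmbedding_generalLinearGroup_val (m := Fin 3) (F := K)).measurableEmbedding
  let Xc : (Fin 18 → K) → Matrix (Fin 3) (Fin 3) K := fun y => Matrix.of fun i j : Fin 3 =>
    y (finProdFinEquiv (finProdFinEquiv (i, j), (0 : Fin 2))) + θ * y (finProdFinEquiv (finProdFinEquiv (i, j), (1 : Fin 2)))
  have hXc : Continuous Xc :=
    continuous_matrix fun i j => ((continuous_apply _).add (continuous_const.mul (continuous_apply _)))
  let ιK : (Fin 18 → K) → GL (Fin 3) K := fun y =>
    if hd : (Xc y).det ≠ 0 then Matrix.GeneralLinearGroup.mkOfDetNeZero (Xc y) hd else 1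
  have hιK_val : ∀ y, ((ιK y : GL (Fin 3) K) : Matrix (Fin 3) (Fin 3) K) = if (Xc y).det ≠ 0 then Xc y else 1 := by
    intro y
    by_cases hd : (Xc y).det ≠ 0
    · simp only [ιK, dif_pos hd, if_pos hd]; rfl
    · simp only [ιK, dif_neg hd, if_neg hd, Units.val_one]
  have hιK : Measurable ιK := by
    refine hval.measurable_comp_iff.1 ?_
    have hfun : (Units.val ∘ ιK) = fun y => if (Xc y).det ≠ 0 then Xc y else 1 := funext fun y => hιK_val y
    rw [hfun]
    refine Measurable.ite ?_ hXc.measurable measurable_const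
    exact (hXc.matrix_det).measurable (measurableSet_singleton (0 : K)).compl
  let ys : (Fin 18 → X) → (Fin 18 → K) := fun τ n => e (τ n)
  have hys : Measurable ys := measurable_pi_lambda _ fun n => he.comp (measurable_pi_apply n)
  have hι : Measurable (fun τ : Fin 18 → X => ιK (ys τ)) := hιK.comp hys
  have hμT : Measure.pi (fun _ : Fin 18 => μ) ≠ 0 := by
    intro h0
    have h1 : Measure.pi (fun _ : Fin 18 => μ) Set.univ = 0 := by rw [h0]; rfl
    rw [Measure.pi_univ] at h1
    obtain ⟨i, -, hi⟩ := Finset.prod_eq_zero_iff.mp h1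
    exact hμ (Measure.measure_univ_eq_zero.mp hi)
  have hS : MeasurableSet {g : GL (Fin 3) K |
      ((g : Matrix (Fin 3) (Fin 3) K) * B * (adjugate ((g : Matrix (Fin 3) (Fin 3) K).map σ))ᵀ * C).charpoly.discr = 0} := by
    have hc : Continuous fun g : GL (Fin 3) K =>
        ((g : Matrix (Fin 3) (Fin 3) K) * B * (adjugate ((g : Matrix (Fin 3) (Fin 3) K).map σ))ᵀ * C).charpoly.discr :=
      K2E3NormalizedCharBddNearSemisimpleRegular.continuous_discr_charpoly.comp
        (((Units.continuous_val.matrix_mul continuous_const).matrix_mul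
          ((Units.continuous_val.matrix_map hσ).matrix_adjugate.matrix_transpose)).matrix_mul continuous_const)
    exact (isClosed_eq hc continuous_const).measurableSet
  refine measure_eq_zero_of_forall_shear_null ν (Measure.pi fun _ : Fin 18 => μ) hμT hι hS fun g => ?_
  obtain ⟨D, hD, hD0⟩ := exists_mvPolynomial_chart_det (K := K) θ
  obtain ⟨P, hP, hP0⟩ := exists_mvPolynomial_twistedNorm_discr θ (g : Matrix (Fin 3) (Fin 3) K) ((g : Matrix (Fin 3) (Fin 3) K).map σ) B C
  have hPne : P ≠ 0 :=
    hP0 (exists_twistedNorm_discr_ne_zero hθ0 g (Matrix.GeneralLinearGroup.map σ g).isUnit B C hBC)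
  have hsub : {τ : Fin 18 → X | ιK (ys τ) * g ∈ {g : GL (Fin 3) K |
        ((g : Matrix (Fin 3) (Fin 3) K) * B * (adjugate ((g : Matrix (Fin 3) (Fin 3) K).map σ))ᵀ * C).charpoly.discr = 0}} ⊆
      {τ : Fin 18 → X | MvPolynomial.eval (fun i => e (τ i)) D = 0} ∪ {τ : Fin 18 → X | MvPolynomial.eval (fun i => e (τ i)) P = 0} := by
    intro τ hτ
    by_cases hd : (Xc (ys τ)).det = 0
    · left
      show MvPolynomial.eval (ys τ) D = 0
      rw [hD]; exact hd
    · right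
      show MvPolynomial.eval (ys τ) P = 0
      have hv : ((ιK (ys τ) : GL (Fin 3) K) : Matrix (Fin 3) (Fin 3) K) = Xc (ys τ) := by rw [hιK_val, if_pos hd]
      have hτ' : ((Xc (ys τ) * (g : Matrix (Fin 3) (Fin 3) K)) * B * (adjugate ((Xc (ys τ) * (g : Matrix (Fin 3) (Fin 3) K)).map σ))ᵀ * C).charpoly.discr = 0 := by
        have h := hτ
        simp only [Set.mem_setOf_eq, Units.val_mul, hv] at h
        exact h
      rw [map_chart_mul_eq_of_fixed σ θ hθ (g : Matrix (Fin 3) (Fin 3) K) (ys τ) (fun n => hfix (τ n))] at hτ'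
      rw [hP]
      exact hτ'
  refine measure_mono_null hsub (measure_union_null ?_ ?_)
  · exact pi_zeroLocus_mvPolynomial_eq_zero he hinj μ 18 D hD0
  · exact pi_zeroLocus_mvPolynomial_eq_zero he hinj μ 18 P hPne

end Shear

/-! ## §3 The CM instantiation at a non-split place -/

section CM

variable (L : Type) [Field L] [NumberField L] [IsCMField L] (Φ : GL (Fin 3) L)
  (v : HeightOneSpectrum (𝓞 ↥(maximalRealSubfield L)))

/-- **The norm read at the place `w`.**  For `w ∣ v` with `c • w = w` and `π_w` the evaluation `L ⊗ L⁺_v → L_w`: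
`π_w(N δ) = δ_w · B_w · ((σ_w δ_w)⁻¹)ᵀ · C_w` with `δ_w = π_w δ`, `B_w = π_w(Φ_v⁻¹)`, `C_w = π_w((Φ_v⁻¹)⁻¹)` (★ `twistLocal_apply`, ★ `conjLocal_apply_of_smul_eq`).
[cite: Rogawski1990, §3.11 p. 34; §4.10 p. 57] [cite: CasselsFrohlichANT1967, Ch. VII §1.1] -/
theorem map_eval_epsNorm_eq (w : PlacesOver L v) (hw : IsCMField.complexConj L • w.1 = w.1) (δ : GtLoc L v) :
    (epsNorm (epsLoc L Φ v) δ).val.map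
        (Pi.evalRingHom (fun w' : PlacesOver L v => w'.1.adicCompletion L) w) =
      (δ.val.map (Pi.evalRingHom (fun w' : PlacesOver L v => w'.1.adicCompletion L) w)) *
        ((((formLocal L 3 Φ v)⁻¹).val.map
            (Pi.evalRingHom (fun w' : PlacesOver L v => w'.1.adicCompletion L) w)) *
          (((δ.val.map (Pi.evalRingHom (fun w' : PlacesOver L v => w'.1.adicCompletion L) w)).map
              (galAdicCompletionMap (L := L) (IsCMField.complexConj L) hw))⁻¹)ᵀ *
          (((formLocal L 3 Φ v)⁻¹⁻¹).val.map
            (Pi.evalRingHom (fun w' : PlacesOver L v => w'.1.adicCompletion L) w))) := by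
  set c := IsCMField.complexConj L with hcdef
  have hc : c ≠ 1 := IsCMField.complexConj_ne_one L
  set π := Pi.evalRingHom (fun w' : PlacesOver L v => w'.1.adicCompletion L) w with hπ
  have hI : ∀ x : UnitaryGroup.LocalRing L v, π (conjLocal L c v x) = galAdicCompletionMap (L := L) c hw (π x) := fun x =>
    K2LiuLocalRingInertReading.conjLocal_apply_of_smul_eq c hc v w hw x
  have hN : (epsNorm (epsLoc L Φ v) δ).val =
      δ.val * (((formLocal L 3 Φ v)⁻¹).val * (((Matrix.GeneralLinearGroup.map (conjLocal L c v) δ)⁻¹).val)ᵀ * ((formLocal L 3 Φ v)⁻¹⁻¹).val) := by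
    rw [show epsNorm (epsLoc L Φ v) δ = δ * epsLoc L Φ v δ from rfl, epsLoc_apply, twistLocal_apply, Units.val_mul, Units.val_mul, Units.val_mul,
      Literature.NumberTheory.GaloisRepresentations.coe_glTransposeInv_apply]
  have hinv : (((Matrix.GeneralLinearGroup.map (conjLocal L c v) δ)⁻¹).val).map π =
      ((δ.val.map π).map (galAdicCompletionMap (L := L) c hw))⁻¹ := by
    have h1 : (((Matrix.GeneralLinearGroup.map (conjLocal L c v) δ)⁻¹).val).map π =
        (Matrix.GeneralLinearGroup.map π ((Matrix.GeneralLinearGroup.map (conjLocal L c v) δ)⁻¹)).val := rfl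
    rw [h1, map_inv, Matrix.coe_units_inv]
    congr 1
    refine Matrix.ext fun i j => ?_
    show π (conjLocal L c v (δ.val i j)) = _
    rw [Matrix.map_apply, Matrix.map_apply]
    exact hI _
  rw [hN, Matrix.map_mul, Matrix.map_mul, Matrix.map_mul, Matrix.transpose_map, hinv]

/-- **Non-ε-regularity transports to the place `w`**: if `N(δ)` is not regular semisimple then the `w`-component
`δ_w · (B_w · ((σ_w δ_w)⁻¹)ᵀ · C_w)` has non-separable characteristic polynomial (evaluation at the unique `w ∣ v` is a ring ISOMORPHISM
`L ⊗ L⁺_v ≃ L_w`, ★ `inert_reading_injective ∕ _surjective`; Mathlib `Polynomial.Separable.map`, `Matrix.charpoly_map`).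
[cite: Rogawski1990, §3.11 p. 34] [cite: CasselsFrohlichANT1967, Ch. II §10] -/
theorem not_separable_twistedNorm_of_not_isEpsRegularAt (w : PlacesOver L v) (hw : IsCMField.complexConj L • w.1 = w.1) {δ : GtLoc L v}
    (hδ : ¬ IsEpsRegularAt L Φ v δ) :
    ¬ ((δ.val.map (Pi.evalRingHom (fun w' : PlacesOver L v => w'.1.adicCompletion L) w)) *
        ((((formLocal L 3 Φ v)⁻¹).val.map
            (Pi.evalRingHom (fun w' : PlacesOver L v => w'.1.adicCompletion L) w)) *
          (((δ.val.map (Pi.evalRingHom (fun w' : PlacesOver L v => w'.1.adicCompletion L) w)).map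
              (galAdicCompletionMap (L := L) (IsCMField.complexConj L) hw))⁻¹)ᵀ *
          (((formLocal L 3 Φ v)⁻¹⁻¹).val.map
            (Pi.evalRingHom (fun w' : PlacesOver L v => w'.1.adicCompletion L) w)))).charpoly.Separable := by
  set c := IsCMField.complexConj L with hcdef
  have hc : c ≠ 1 := IsCMField.complexConj_ne_one L
  set π := Pi.evalRingHom (fun w' : PlacesOver L v => w'.1.adicCompletion L) w with hπ
  intro hsep
  apply hδ
  rw [isEpsRegularAt_iff, isRegularElt_iff]
  have hbij : Function.Bijective π :=
    ⟨K2LiuLocalRingInertReading.inert_reading_injective c hc v w hw, K2LiuLocalRingInertReading.inert_reading_surjective (E := L) v w⟩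
  let πe : UnitaryGroup.LocalRing L v ≃+* w.1.adicCompletion L := RingEquiv.ofBijective π hbij
  have h1 : ((epsNorm (epsLoc L Φ v) δ).val.charpoly.map π).Separable := by
    rw [← Matrix.charpoly_map, map_eval_epsNorm_eq L Φ v w hw δ]
    exact hsep
  have h2 := h1.map (f := (πe.symm : w.1.adicCompletion L →+* UnitaryGroup.LocalRing L v))
  have hcomp : (πe.symm : w.1.adicCompletion L →+* UnitaryGroup.LocalRing L v).comp π = RingHom.id _ :=
    RingHom.ext fun x => πe.symm_apply_apply x
  rwa [Polynomial.map_map, hcomp, Polynomial.map_id] at h2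

/-- **(SING-ε) — THE ε-SINGULAR SET IS HAAR-NULL.**  For `v` non-split in `L ∕ L⁺`, any `Φ ∈ GL₃(L)` and any Haar measure `νGt` on
`G̃_v = GL₃(L ⊗_{L⁺} L⁺_v)`: `νGt {δ | ¬ IsEpsRegularAt L Φ v δ} = 0` («the set of ε-regular elements … its complement has measure zero»;
one-place model + §2 + transport of `νGt`). [cite: Rogawski1990, §12.5 p. 186; §4.9 p. 54; §3.11 p. 34] [cite: HarishChandra1970, Part I §5, Lemma 42] -/
theorem measure_setOf_not_isEpsRegularAt_eq_zero (hns : ∀ w : PlacesOver L v, IsCMField.complexConj L • w.1 = w.1)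
    [MeasurableSpace (GtLoc L v)] [BorelSpace (GtLoc L v)] (νGt : Measure (GtLoc L v)) [νGt.IsHaarMeasure] :
    νGt {δ : GtLoc L v | ¬ IsEpsRegularAt L Φ v δ} = 0 := by
  classical
  obtain ⟨w⟩ : Nonempty (PlacesOver L v) := inferInstance
  have hw : IsCMField.complexConj L • w.1 = w.1 := hns w
  set c := IsCMField.complexConj L with hcdef
  have hc : c ≠ 1 := IsCMField.complexConj_ne_one L
  set π := Pi.evalRingHom (fun w' : PlacesOver L v => w'.1.adicCompletion L) w with hπ
  haveI : T2Space (w.1.adicCompletion L) :=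
    (Literature.NumberTheory.GaloisRepresentations.IsNonarchimedeanLocalField.isLocalField (w.1.adicCompletion L)).toT2Space
  haveI : SecondCountableTopology (w.1.adicCompletion L) := secondCountableTopology_adicCompletion L w.1
  haveI : CharZero (w.1.adicCompletion L) := charZero_of_injective_algebraMap (algebraMap L (w.1.adicCompletion L)).injective
  letI : MeasurableSpace (w.1.adicCompletion L) := borel _
  haveI : BorelSpace (w.1.adicCompletion L) := ⟨rfl⟩
  letI : MeasurableSpace (GL (Fin 3) (w.1.adicCompletion L)) := borel _
  haveI : BorelSpace (GL (Fin 3) (w.1.adicCompletion L)) := ⟨rfl⟩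
  haveI : SecondCountableTopology (Matrix (Fin 3) (Fin 3) (w.1.adicCompletion L)) :=
    inferInstanceAs (SecondCountableTopology (Fin 3 → Fin 3 → w.1.adicCompletion L))
  haveI : SecondCountableTopology (Matrix (Fin 3) (Fin 3) (w.1.adicCompletion L))ᵐᵒᵖ := MulOpposite.opHomeomorph.symm.secondCountableTopology
  haveI : SecondCountableTopology (GL (Fin 3) (w.1.adicCompletion L)) := Units.isEmbedding_embedProduct.secondCountableTopology
  haveI : LocallyCompactSpace (Matrix (Fin 3) (Fin 3) (w.1.adicCompletion L)) :=
    inferInstanceAs (LocallyCompactSpace (Fin 3 → Fin 3 → w.1.adicCompletion L))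
  haveI : LocallyCompactSpace (GL (Fin 3) (w.1.adicCompletion L)) := inferInstance
  let eG : GtLoc L v ≃ₜ* GL (Fin 3) (w.1.adicCompletion L) := (localGLPiEquiv L 3 v).trans (localGLPiEvalEquiv c 3 hc w hw)
  have heG : ∀ δ : GtLoc L v, ((eG δ : GL (Fin 3) (w.1.adicCompletion L)) : Matrix (Fin 3) (Fin 3) (w.1.adicCompletion L)) =
      δ.val.map π := fun δ => rfl
  haveI : (νGt.map eG).IsHaarMeasure := eG.isHaarMeasure_map νGt
  haveI : T2Space (v.adicCompletion ↥(maximalRealSubfield L)) :=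
    (Literature.NumberTheory.GaloisRepresentations.IsNonarchimedeanLocalField.isLocalField (v.adicCompletion ↥(maximalRealSubfield L))).toT2Space
  haveI : SecondCountableTopology (v.adicCompletion ↥(maximalRealSubfield L)) := secondCountableTopology_adicCompletion _ v
  letI : MeasurableSpace (v.adicCompletion ↥(maximalRealSubfield L)) := borel _
  haveI : BorelSpace (v.adicCompletion ↥(maximalRealSubfield L)) := ⟨rfl⟩
  let μF : Measure (v.adicCompletion ↥(maximalRealSubfield L)) := Measure.addHaar
  haveI : NullSingletonClass μF := K2E3GL3CharpolyDiscNull.nullSingletonClass_of_isAddHaarMeasure μF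
  have hμF : μF ≠ 0 := Measure.measure_univ_ne_zero.mp (isOpen_univ.measure_pos μF univ_nonempty).ne'
  obtain ⟨lam, hlam⟩ := exists_units_galAdicCompletionMap_eq_neg c hc v w hw
  have hBC : (((formLocal L 3 Φ v)⁻¹).val.map π) *
      (((formLocal L 3 Φ v)⁻¹⁻¹).val.map π) = 1 := by
    rw [← Matrix.map_mul, ← Units.val_mul, mul_inv_cancel, Units.val_one, Matrix.map_one π (map_zero π) (map_one π)]
  have hgen := measure_setOf_discr_twistedNorm_eq_zero (galAdicCompletionMap (L := L) c hw) (continuous_galAdicCompletionMap L c hw) hlam lam.ne_zero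
    _ _ hBC (e := toPlace v w) (continuous_toPlace v w).measurable (toPlace v w).injective (fun x => galAdicCompletionMap_toPlace c w w hw x)
    μF hμF (νGt.map eG)
  have hsub : {δ : GtLoc L v | ¬ IsEpsRegularAt L Φ v δ} ⊆ eG ⁻¹' {g : GL (Fin 3) (w.1.adicCompletion L) |
      ((g : Matrix (Fin 3) (Fin 3) (w.1.adicCompletion L)) *
            (((formLocal L 3 Φ v)⁻¹).val.map π) *
          (adjugate ((g : Matrix (Fin 3) (Fin 3) (w.1.adicCompletion L)).map (galAdicCompletionMap (L := L) c hw)))ᵀ *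
        (((formLocal L 3 Φ v)⁻¹⁻¹).val.map π)).charpoly.discr = 0} := by
    intro δ hδ
    rw [Set.mem_preimage, Set.mem_setOf_eq, heG]
    have hdet : ((δ.val.map π).map (galAdicCompletionMap (L := L) c hw)).det ≠ 0 :=
      ((Matrix.isUnit_iff_isUnit_det _).mp
        (Matrix.GeneralLinearGroup.map (galAdicCompletionMap (L := L) c hw) (Matrix.GeneralLinearGroup.map π δ)).isUnit).ne_zero
    exact discr_charpoly_twistedNorm_eq_zero_of_not_separable (galAdicCompletionMap (L := L) c hw) _ _ _ hdet
      (not_separable_twistedNorm_of_not_isEpsRegularAt L Φ v w hw hδ)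
  exact measure_mono_null hsub (nonpos_iff_eq_zero.mp ((Measure.le_map_apply eG.continuous.measurable.aemeasurable _).trans hgen.le))

/-- **(SING-ε), `∀ᵐ` form**: `νGt`-almost every `δ ∈ G̃_v` is ε-regular. [cite: Rogawski1990, §12.5 p. 186; §3.11 p. 34] -/
theorem ae_isEpsRegularAt (hns : ∀ w : PlacesOver L v, IsCMField.complexConj L • w.1 = w.1)
    [MeasurableSpace (GtLoc L v)] [BorelSpace (GtLoc L v)] (νGt : Measure (GtLoc L v)) [νGt.IsHaarMeasure] :
    ∀ᵐ δ ∂νGt, IsEpsRegularAt L Φ v δ := by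
  rw [ae_iff]
  exact measure_setOf_not_isEpsRegularAt_eq_zero L Φ v hns νGt

/-- **(SING-ε) at the quasi-split form of record `Φ₃ = splitFormGL L`** (the letter of the (B1) assembly, HEADS v2 §3):
`νGt {δ | ¬ IsEpsRegularAt L (splitFormGL L) v δ} = 0`. [cite: Rogawski1990, §12.5 p. 186; §12.2 p. 171] -/
theorem measure_setOf_not_isEpsRegularAt_splitFormGL_eq_zero (hns : ∀ w : PlacesOver L v, IsCMField.complexConj L • w.1 = w.1)
    [MeasurableSpace (GtLoc L v)] [BorelSpace (GtLoc L v)] (νGt : Measure (GtLoc L v)) [νGt.IsHaarMeasure] :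
    νGt {δ : GtLoc L v | ¬ IsEpsRegularAt L (splitFormGL L) v δ} = 0 :=
  measure_setOf_not_isEpsRegularAt_eq_zero L (splitFormGL L) v hns νGt

/-- **(SING-ε) at `Φ₃`, `∀ᵐ` form.** [cite: Rogawski1990, §12.5 p. 186; §12.2 p. 171] -/
theorem ae_isEpsRegularAt_splitFormGL (hns : ∀ w : PlacesOver L v, IsCMField.complexConj L • w.1 = w.1)
    [MeasurableSpace (GtLoc L v)] [BorelSpace (GtLoc L v)] (νGt : Measure (GtLoc L v)) [νGt.IsHaarMeasure] :
    ∀ᵐ δ ∂νGt, IsEpsRegularAt L (splitFormGL L) v δ :=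
  ae_isEpsRegularAt L (splitFormGL L) v hns νGt

end CM

end Summit.HodgeConjecture.HodgeConjecture.R90.S4

end
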